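import Summits.Ventures.HodgeRepro2.T5SU11SphericalTwo

/-!
# The functional equation `φ_λ = φ_{2-λ}` of the spherical functions of `SU(1,1)`

Harish-Chandra's spherical functions `sph λ g = ∫_K e^{λ t(k g)} dk` of `T5SU11SphericalFunction`
satisfy the classical **functional equation `φ_λ = φ_{2ρ-λ}`, `2ρ = 2`** (`sph_two_sub`). The proof is
the change of variables on the circle `K = B\G` under the boundary action of `a_t`: in the angle
variable, `sph λ (a_t) = (2π)⁻¹ ∫_{-π}^{π} G_t(φ)^{-λ} dφ` with `G_t(φ) = |cosh t - sinh t e^{iφ}|`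
(`sph_hyp_eq_intervalIntegral`; `G_t(φ)² = cosh² t + sinh² t - 2 cosh t sinh t cos φ`, `gnorm_sq`), and
the boundary action of `a_t` in the angle coordinate is the smooth map
`ψ_t(φ) = φ - 2 arctan (sinh t sin φ / (cosh t + sinh t cos φ))` (`bdry`; `e^{iψ} = e^{iφ} w̄ / w` with
`w = cosh t + sinh t e^{iφ}`), which fixes `±π` (`bdry_pi`, `bdry_neg_pi`), has derivative
`ψ_t'(φ) = 1 / P_t(φ)` with `P_t(φ) = |cosh t + sinh t e^{iφ}|² = cosh 2t + sinh 2t cos φ` the Poisson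
denominator (`hasDerivAt_bdry`), and satisfies the Möbius identity `G_t(ψ_t(φ))² = 1 / P_t(φ)`
(`gnorm_bdry_sq`). Substituting, `∫ G_t^{-λ} = ∫ G_t(ψ)^{-λ} ψ' = ∫ P_t^{λ/2 - 1} = ∫ G_t(φ + π)^{λ - 2}`
(`gnorm_bdry_rpow_mul`, `P_t(φ) = G_t(φ + π)²`), and the shift by `π` is absorbed by `2π`-periodicity
(`intervalIntegral_gnorm_rpow_symm`). Hence `sph λ (a_t) = sph (2 - λ) (a_t)` (`sph_two_sub_hyp`) and, by
the Cartan decomposition, `sph λ g = sph (2 - λ) g` for every `g` (`sph_two_sub`); with `φ_0 ≡ 1`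
(`sph_zero`) this gives a second proof of `φ_2 ≡ 1` (`sph_two_of_symm`, cf.
`T5SU11SphericalTwo.sph_two`). Nothing is claimed about (N).

Blind lane: Mathlib + the HodgeRepro2 prefix only; no sorry; axioms ⊆ {propext, Classical.choice,
Quot.sound}.
-/

namespace Summit.Ventures.HodgeRepro2.T5SU11SphericalSymmetry

open MeasureTheory Metric Set Complex intervalIntegral
open T5SU11Unimodular T5SU11Cartan T5SU11CartanProjection T5HaarCircle T5SU11SphericalFunction
  T5SU11SphericalTwo
open scoped Real

/-! ### The angular integrand `G_t(φ) = |cosh t - sinh t e^{iφ}|` and the Poisson denominator -/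

/-- `gnorm t φ = |cosh t - sinh t e^{iφ}|`: the integrand of `sph λ (a_t)` in the angle variable. -/
noncomputable def gnorm (t φ : ℝ) : ℝ := ‖(Real.cosh t : ℂ) - circleMap 0 (Real.sinh t) φ‖

/-- `pden t φ = (cosh t + sinh t cos φ)² + (sinh t sin φ)² = |cosh t + sinh t e^{iφ}|²`, the Poisson
denominator (`= cosh 2t + sinh 2t cos φ`). -/
noncomputable def pden (t φ : ℝ) : ℝ :=
  (Real.cosh t + Real.sinh t * Real.cos φ) ^ 2 + (Real.sinh t * Real.sin φ) ^ 2

/-- `|sinh t| < cosh t`. -/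
lemma abs_sinh_lt_cosh (t : ℝ) : |Real.sinh t| < Real.cosh t := by
  rw [Real.abs_sinh, ← Real.cosh_abs]
  exact Real.sinh_lt_cosh _

/-- `cosh t + sinh t cos φ > 0`: the real part of `w = cosh t + sinh t e^{iφ}` is positive. -/
lemma cosh_add_sinh_mul_cos_pos (t φ : ℝ) : 0 < Real.cosh t + Real.sinh t * Real.cos φ := by
  have h1 := abs_sinh_lt_cosh t
  have h2 : |Real.sinh t * Real.cos φ| ≤ |Real.sinh t| := by
    rw [abs_mul]
    exact mul_le_of_le_one_right (abs_nonneg _) (Real.abs_cos_le_one φ)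
  linarith [neg_abs_le (Real.sinh t * Real.cos φ)]

/-- `pden t φ > 0`. -/
lemma pden_pos (t φ : ℝ) : 0 < pden t φ :=
  add_pos_of_pos_of_nonneg (pow_pos (cosh_add_sinh_mul_cos_pos t φ) 2) (sq_nonneg _)

/-- `pden t φ = cosh² t + sinh² t + 2 cosh t sinh t cos φ` (`= cosh 2t + sinh 2t cos φ`). -/
lemma pden_eq (t φ : ℝ) :
    pden t φ = Real.cosh t ^ 2 + Real.sinh t ^ 2 + 2 * Real.cosh t * Real.sinh t * Real.cos φ := by
  unfold pden
  linear_combination (Real.sinh t ^ 2) * Real.sin_sq_add_cos_sq φ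

/-- `pden` is continuous in `φ`. -/
lemma continuous_pden (t : ℝ) : Continuous (pden t) := by
  unfold pden
  fun_prop

/-- `φ ↦ (pden t φ)⁻¹` is continuous. -/
lemma continuous_pden_inv (t : ℝ) : Continuous fun φ => (pden t φ)⁻¹ :=
  (continuous_pden t).inv₀ fun φ => (pden_pos t φ).ne'

/-- **`G_t(φ)² = cosh² t + sinh² t - 2 cosh t sinh t cos φ`.** -/
lemma gnorm_sq (t φ : ℝ) :
    gnorm t φ ^ 2 =
      Real.cosh t ^ 2 + Real.sinh t ^ 2 - 2 * Real.cosh t * Real.sinh t * Real.cos φ := by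
  unfold gnorm
  rw [← Complex.normSq_eq_norm_sq, circleMap_zero, Complex.exp_mul_I, ← Complex.ofReal_cos,
    ← Complex.ofReal_sin, Complex.normSq_apply]
  simp only [Complex.sub_re, Complex.sub_im, Complex.ofReal_re, Complex.ofReal_im, Complex.mul_re,
    Complex.mul_im, Complex.add_re, Complex.add_im, Complex.I_re, Complex.I_im, mul_zero, zero_mul,
    sub_zero, add_zero, mul_one, zero_add, zero_sub, sub_self]
  linear_combination (Real.sinh t ^ 2) * Real.sin_sq_add_cos_sq φ

/-- `G_t(φ)² = pden t (φ + π)`. -/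
lemma gnorm_sq_eq_pden (t φ : ℝ) : gnorm t φ ^ 2 = pden t (φ + π) := by
  rw [gnorm_sq, pden, Real.cos_add_pi, Real.sin_add_pi]
  linear_combination (-(Real.sinh t ^ 2)) * Real.sin_sq_add_cos_sq φ

/-- **`pden t φ = G_t(φ + π)²`**: the Poisson denominator is the square of the shifted integrand. -/
lemma pden_eq_gnorm_sq (t φ : ℝ) : pden t φ = gnorm t (φ + π) ^ 2 := by
  rw [gnorm_sq, Real.cos_add_pi, pden]
  linear_combination (Real.sinh t ^ 2) * Real.sin_sq_add_cos_sq φ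

/-- `G_t(φ) > 0`. -/
lemma gnorm_pos (t φ : ℝ) : 0 < gnorm t φ := by
  have h : 0 < gnorm t φ ^ 2 := by
    rw [gnorm_sq_eq_pden]
    exact pden_pos t (φ + π)
  by_contra hcon
  have h0 : gnorm t φ = 0 := le_antisymm (not_lt.mp hcon) (norm_nonneg _)
  rw [h0] at h
  norm_num at h

/-- `gnorm t` is continuous. -/
lemma continuous_gnorm (t : ℝ) : Continuous (gnorm t) :=
  (continuous_const.sub (continuous_circleMap 0 (Real.sinh t))).norm

/-- `φ ↦ G_t(φ)^s` is continuous for every real exponent `s`. -/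
lemma continuous_gnorm_rpow (t s : ℝ) : Continuous fun φ => gnorm t φ ^ s :=
  (continuous_gnorm t).rpow_const fun φ => Or.inl (gnorm_pos t φ).ne'

/-- `G_t` is `2π`-periodic. -/
lemma periodic_gnorm (t : ℝ) : Function.Periodic (gnorm t) (2 * π) := fun φ => by
  simp only [gnorm, periodic_circleMap 0 (Real.sinh t) φ]

/-- `φ ↦ G_t(φ)^s` is `2π`-periodic. -/
lemma periodic_gnorm_rpow (t s : ℝ) : Function.Periodic (fun φ => gnorm t φ ^ s) (2 * π) :=
  fun φ => by simp only [periodic_gnorm t φ]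

/-! ### The boundary action of `a_t` in the angle coordinate -/

/-- The boundary action of `a_t` on the circle in the angle coordinate:
`bdry t φ = φ - 2 arctan (sinh t sin φ / (cosh t + sinh t cos φ))`, so that
`e^{i bdry t φ} = e^{iφ} · w̄ / w` with `w = cosh t + sinh t e^{iφ}` (`Re w > 0`). -/
noncomputable def bdry (t φ : ℝ) : ℝ :=
  φ - 2 * Real.arctan (Real.sinh t * Real.sin φ / (Real.cosh t + Real.sinh t * Real.cos φ))

/-- `bdry t π = π`. -/
lemma bdry_pi (t : ℝ) : bdry t π = π := by
  unfold bdry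
  rw [Real.sin_pi, mul_zero, zero_div, Real.arctan_zero, mul_zero, sub_zero]

/-- `bdry t (-π) = -π`. -/
lemma bdry_neg_pi (t : ℝ) : bdry t (-π) = -π := by
  unfold bdry
  rw [Real.sin_neg, Real.sin_pi, neg_zero, mul_zero, zero_div, Real.arctan_zero, mul_zero, sub_zero]

/-- `1 + (N/D)² = pden t φ / D²` with `D = cosh t + sinh t cos φ`, `N = sinh t sin φ`. -/
lemma one_add_div_sq (t φ : ℝ) :
    1 + (Real.sinh t * Real.sin φ / (Real.cosh t + Real.sinh t * Real.cos φ)) ^ 2 =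
      pden t φ / (Real.cosh t + Real.sinh t * Real.cos φ) ^ 2 := by
  rw [pden, div_pow, add_div, div_self (pow_ne_zero 2 (cosh_add_sinh_mul_cos_pos t φ).ne')]

/-- `pden t φ - 2 (sinh t cos φ · D + N²) = cosh² t - sinh² t = 1`. -/
lemma pden_sub_two_mul (t φ : ℝ) :
    pden t φ - 2 * (Real.sinh t * Real.cos φ * (Real.cosh t + Real.sinh t * Real.cos φ) +
      Real.sinh t * Real.sin φ * (Real.sinh t * Real.sin φ)) = 1 := by
  unfold pden
  linear_combination Real.cosh_sq_sub_sinh_sq t + (-(Real.sinh t ^ 2)) * Real.sin_sq_add_cos_sq φ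

/-- **The derivative of the boundary action is the inverse Poisson denominator**:
`bdry t` has derivative `1 / pden t φ` at `φ`. -/
theorem hasDerivAt_bdry (t φ : ℝ) : HasDerivAt (bdry t) (pden t φ)⁻¹ φ := by
  have hD : Real.cosh t + Real.sinh t * Real.cos φ ≠ 0 := (cosh_add_sinh_mul_cos_pos t φ).ne'
  have hp : pden t φ ≠ 0 := (pden_pos t φ).ne'
  have hnum : HasDerivAt (fun φ => Real.sinh t * Real.sin φ) (Real.sinh t * Real.cos φ) φ :=
    (Real.hasDerivAt_sin φ).const_mul _
  have hden : HasDerivAt (fun φ => Real.cosh t + Real.sinh t * Real.cos φ)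
      (Real.sinh t * -Real.sin φ) φ :=
    ((Real.hasDerivAt_cos φ).const_mul _).const_add _
  have h := (hasDerivAt_id' (x := φ)).sub (((hnum.div hden hD).arctan).const_mul (2 : ℝ))
  refine h.congr_deriv ?_
  simp only [Pi.div_apply]
  rw [one_add_div_sq, show Real.sinh t * Real.cos φ * (Real.cosh t + Real.sinh t * Real.cos φ) -
      Real.sinh t * Real.sin φ * (Real.sinh t * -Real.sin φ) =
      Real.sinh t * Real.cos φ * (Real.cosh t + Real.sinh t * Real.cos φ) +
        Real.sinh t * Real.sin φ * (Real.sinh t * Real.sin φ) by ring,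
    one_div_div, div_mul_div_comm, mul_comm ((Real.cosh t + Real.sinh t * Real.cos φ) ^ 2),
    mul_div_mul_right _ _ (pow_ne_zero 2 hD), ← mul_div_assoc, inv_eq_one_div, eq_div_iff hp,
    sub_mul, one_mul, div_mul_cancel₀ _ hp]
  exact pden_sub_two_mul t φ

/-- `cos (bdry t φ)` in closed form:
`cos ψ = (cos φ (D² - N²) + 2 N D sin φ) / pden t φ` with `D = cosh t + sinh t cos φ`, `N = sinh t sin φ`. -/
lemma cos_bdry (t φ : ℝ) :
    Real.cos (bdry t φ) =
      (Real.cos φ * ((Real.cosh t + Real.sinh t * Real.cos φ) ^ 2 - (Real.sinh t * Real.sin φ) ^ 2) +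
        2 * (Real.sinh t * Real.sin φ) * (Real.cosh t + Real.sinh t * Real.cos φ) * Real.sin φ) /
        pden t φ := by
  have hD : Real.cosh t + Real.sinh t * Real.cos φ ≠ 0 := (cosh_add_sinh_mul_cos_pos t φ).ne'
  have hp : pden t φ ≠ 0 := (pden_pos t φ).ne'
  have h1 : Real.cos (2 * Real.arctan (Real.sinh t * Real.sin φ /
      (Real.cosh t + Real.sinh t * Real.cos φ))) =
      2 * (1 / (1 + (Real.sinh t * Real.sin φ / (Real.cosh t + Real.sinh t * Real.cos φ)) ^ 2)) - 1 := by
    rw [Real.cos_two_mul, Real.cos_sq_arctan]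
  have h2 : Real.sin (2 * Real.arctan (Real.sinh t * Real.sin φ /
      (Real.cosh t + Real.sinh t * Real.cos φ))) =
      2 * (Real.sinh t * Real.sin φ / (Real.cosh t + Real.sinh t * Real.cos φ) /
        (1 + (Real.sinh t * Real.sin φ / (Real.cosh t + Real.sinh t * Real.cos φ)) ^ 2)) := by
    rw [Real.sin_two_mul, mul_assoc, Real.sin_arctan, Real.cos_arctan, div_mul_div_comm, mul_one,
      Real.mul_self_sqrt (by positivity)]
  unfold bdry
  rw [Real.cos_sub, h1, h2, one_add_div_sq]
  field_simp
  unfold pden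
  ring

/-- **The Möbius identity `G_t(bdry t φ)² = 1 / pden t φ`**: the integrand at the image point is the
inverse Poisson denominator at the source point. -/
theorem gnorm_bdry_sq (t φ : ℝ) : gnorm t (bdry t φ) ^ 2 = (pden t φ)⁻¹ := by
  set C := Real.cosh t with hC
  set S := Real.sinh t with hS
  have hp : pden t φ ≠ 0 := (pden_pos t φ).ne'
  have key : (C ^ 2 + S ^ 2) * pden t φ -
      2 * C * S * (Real.cos φ * ((C + S * Real.cos φ) ^ 2 - (S * Real.sin φ) ^ 2) +
        2 * (S * Real.sin φ) * (C + S * Real.cos φ) * Real.sin φ) = 1 := by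
    unfold pden
    linear_combination (C ^ 2 - S ^ 2 + 1) * Real.cosh_sq_sub_sinh_sq t +
      (S ^ 4 - 3 * C ^ 2 * S ^ 2 - 2 * C * S ^ 3 * Real.cos φ) * Real.sin_sq_add_cos_sq φ
  rw [gnorm_sq, cos_bdry]
  apply eq_inv_of_mul_eq_one_left
  field_simp
  linear_combination key

/-- **The substituted integrand**: `G_t(bdry t φ)^{-λ} · (pden t φ)⁻¹ = G_t(φ + π)^{-(2 - λ)}`. -/
theorem gnorm_bdry_rpow_mul (t lam φ : ℝ) :
    gnorm t (bdry t φ) ^ (-lam) * (pden t φ)⁻¹ = gnorm t (φ + π) ^ (-(2 - lam)) := by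
  have hg : 0 < gnorm t (bdry t φ) := gnorm_pos _ _
  have hp : 0 < pden t φ := pden_pos _ _
  have hg' : 0 < gnorm t (φ + π) := gnorm_pos _ _
  calc gnorm t (bdry t φ) ^ (-lam) * (pden t φ)⁻¹
      = (gnorm t (bdry t φ) ^ 2) ^ (-lam / 2) * (pden t φ)⁻¹ := by
        rw [← Real.rpow_natCast, ← Real.rpow_mul hg.le]
        congr 2
        push_cast
        ring
    _ = (pden t φ)⁻¹ ^ (-lam / 2) * (pden t φ)⁻¹ := by rw [gnorm_bdry_sq]
    _ = pden t φ ^ (lam / 2) * (pden t φ)⁻¹ := by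
        rw [Real.inv_rpow hp.le, neg_div, Real.rpow_neg hp.le, inv_inv]
    _ = pden t φ ^ (lam / 2 - 1) := by
        rw [Real.rpow_sub_one hp.ne']
        ring
    _ = (gnorm t (φ + π) ^ 2) ^ (lam / 2 - 1) := by rw [pden_eq_gnorm_sq]
    _ = gnorm t (φ + π) ^ (-(2 - lam)) := by
        rw [← Real.rpow_natCast, ← Real.rpow_mul hg'.le]
        congr 1
        push_cast
        ring

/-! ### The circle integral and the functional equation -/

/-- The reparametrisation `θ ↦ -2θ` of a continuous `2π`-periodic function:
`∫_0^{2π} g(-2θ) dθ = ∫_{-π}^{π} g(φ) dφ`. -/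
theorem intervalIntegral_comp_neg_two_mul {g : ℝ → ℝ} (hper : Function.Periodic g (2 * π))
    (hcont : Continuous g) : ∫ θ in (0 : ℝ)..2 * π, g (-2 * θ) = ∫ φ in (-π)..π, g φ := by
  have hint : ∀ t₁ t₂ : ℝ, IntervalIntegrable g volume t₁ t₂ := fun t₁ t₂ =>
    hcont.intervalIntegrable t₁ t₂
  have h1 : ∫ θ in (0 : ℝ)..2 * π, g (-2 * θ) =
      (-2 : ℝ)⁻¹ • ∫ θ in (-2 : ℝ) * 0..(-2) * (2 * π), g θ :=
    integral_comp_mul_left (fun θ => g θ) (by norm_num)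
  have h2 : ∫ θ in (-2 : ℝ) * 0..(-2) * (2 * π), g θ =
      -(2 : ℤ) • ∫ θ in (-4 * π)..(-4 * π + 2 * π), g θ := by
    rw [integral_symm, show (-2 : ℝ) * 0 = -4 * π + (2 : ℤ) • (2 * π) by
      rw [zsmul_eq_mul, Int.cast_ofNat]; ring,
      show (-2 : ℝ) * (2 * π) = -4 * π by ring, hper.intervalIntegral_add_zsmul_eq 2 (-4 * π) hint,
      neg_zsmul]
  have h3 : ∫ θ in (-4 * π)..(-4 * π + 2 * π), g θ = ∫ θ in (-π)..(-π + 2 * π), g θ :=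
    hper.intervalIntegral_add_eq (-4 * π) (-π)
  rw [h1, h2, h3, show -π + 2 * π = π by ring]
  simp only [zsmul_eq_mul, Int.cast_neg, Int.cast_ofNat, smul_eq_mul]
  ring

/-- **`sph λ (a_t)` as an interval integral in the angle variable**:
`sph λ (a_t) = (2π)⁻¹ ∫_{-π}^{π} G_t(φ)^{-λ} dφ`. -/
theorem sph_hyp_eq_intervalIntegral [MeasurableSpace Circle] [BorelSpace Circle] (lam t : ℝ) :
    sph lam (hyp t) = (2 * π)⁻¹ * ∫ φ in (-π)..π, gnorm t φ ^ (-lam) := by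
  rw [sph_hyp, integral_haarCircle]
  simp_rw [conj_exp_sq_mul]
  rw [show (fun θ : ℝ => ‖(Real.cosh t : ℂ) - circleMap 0 (Real.sinh t) (-2 * θ)‖ ^ (-lam)) =
    fun θ => gnorm t (-2 * θ) ^ (-lam) from rfl, smul_eq_mul,
    intervalIntegral_comp_neg_two_mul (periodic_gnorm_rpow t (-lam)) (continuous_gnorm_rpow t (-lam))]

/-- **The functional equation of the angular integral**:
`∫_{-π}^{π} G_t(φ)^{-λ} dφ = ∫_{-π}^{π} G_t(φ)^{-(2-λ)} dφ` (the substitution `φ = bdry t x`, the Möbius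
identity, and the shift by `π`). -/
theorem intervalIntegral_gnorm_rpow_symm (t lam : ℝ) :
    ∫ φ in (-π)..π, gnorm t φ ^ (-lam) = ∫ φ in (-π)..π, gnorm t φ ^ (-(2 - lam)) := by
  have hcv := intervalIntegral.integral_comp_mul_deriv (a := -π) (b := π) (f := bdry t)
    (f' := fun x => (pden t x)⁻¹) (g := fun φ => gnorm t φ ^ (-lam))
    (fun x _ => hasDerivAt_bdry t x) (continuous_pden_inv t).continuousOn
    (continuous_gnorm_rpow t (-lam))
  rw [bdry_neg_pi, bdry_pi] at hcv
  rw [← hcv]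
  simp only [Function.comp_def]
  simp_rw [gnorm_bdry_rpow_mul]
  have hshift : ∫ x in (-π)..π, gnorm t (x + π) ^ (-(2 - lam)) =
      ∫ φ in (-π + π)..(π + π), gnorm t φ ^ (-(2 - lam)) :=
    intervalIntegral.integral_comp_add_right (fun φ => gnorm t φ ^ (-(2 - lam))) π
  rw [hshift, show -π + π = (0 : ℝ) by ring, show π + π = (0 : ℝ) + 2 * π by ring,
    (periodic_gnorm_rpow t (-(2 - lam))).intervalIntegral_add_eq 0 (-π),
    show -π + 2 * π = π by ring]

section measure

variable [MeasurableSpace Circle] [BorelSpace Circle]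

/-- **The functional equation on `A`**: `sph λ (a_t) = sph (2 - λ) (a_t)`. -/
theorem sph_two_sub_hyp (lam t : ℝ) : sph lam (hyp t) = sph (2 - lam) (hyp t) := by
  rw [sph_hyp_eq_intervalIntegral, sph_hyp_eq_intervalIntegral, intervalIntegral_gnorm_rpow_symm]

/-- **The functional equation `φ_λ = φ_{2-λ}`**: `sph λ g = sph (2 - λ) g` for every `g ∈ SU(1,1)`
(`2ρ = 2` for `SU(1,1)`). -/
theorem sph_two_sub (lam : ℝ) (g : SU11) : sph lam g = sph (2 - lam) g := by
  rw [sph_eq_sph_hyp_cartanT, sph_two_sub_hyp, ← sph_eq_sph_hyp_cartanT]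

/-- **`φ_0 ≡ 1`**: `sph 0 g = 1`. -/
theorem sph_zero (g : SU11) : sph 0 g = 1 := by
  unfold sph
  simp_rw [zero_mul, Real.exp_zero]
  rw [MeasureTheory.integral_const, measureReal_def, haarCircle_univ, ENNReal.toReal_one, one_smul]

/-- **`φ_2 ≡ 1` from the functional equation** (a second proof of `T5SU11SphericalTwo.sph_two`):
`sph 2 g = sph (2 - 0) g = sph 0 g = 1`. -/
theorem sph_two_of_symm (g : SU11) : sph 2 g = 1 := by
  rw [show (2 : ℝ) = 2 - 0 by norm_num, ← sph_two_sub, sph_zero]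

end measure

end Summit.Ventures.HodgeRepro2.T5SU11SphericalSymmetry
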